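import Mathlib
import Summits.HodgeConjecture.FermatCycles.HodgeFermatHypUCertB

/-!
# HYPOTHESIS U on a finite range WITHOUT certificate data — the in-kernel certificate generator (`HodgeFermat/HypUAuto.lean`; HF-G24)

Tree copy (whole module) of the module `HodgeFermat/HypUAuto.lean` of the sibling cell's standalone package
`run/shared/lean/pub/pub-hodgefermat/lean/HodgeFermat/` (141 lines, sha256 `f08a7e41bd93d578…`), source lines 21–141 (all: trial-division `factor`, the order certificate generator `linSearch`/`strip`/`reduceOrd`/`lam`, `autoEntry`, the certificate-free walk `walkAuto` and its soundness).
Filed by cell `pub-hfermat`, seat prover-1 gen-2, on the COORDINATOR KEEPER RULING of 2026-08-25 (gem sweep H1: take the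
off-gate kernel theorem `thmFstar` through the gate) — here its second namesake, `HodgeFermat/ThmFstarNFinal.lean:29`,
THEOREM F*(3N) at every admissible squarefree level (the first, `DecodingFinal.thmFstar` = THEOREM F* at the prime levels,
landed on 2026-08-25 as `HodgeFermatThmFstar.lean`, seat prover-1 gen-0); this file is one link of the import closure of
`ThmFstarNFinal.thmFstar` on top of that landed chain.  The source module's declarations are VERBATIM those of the cell record
`check/ThmFstarN_standalone.lean` (21 bodies, 438 871 B, sha256 ced731ec52c92191…, hub `lean check` rc 0, 222.2 s, `--axioms …ThmFstarN.thmFstarN` = [propext, Classical.choice, Quot.sound]; pub-hodgefermat `CERT.md` l.987, GATE HF-G33).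
Deviations from the source module, exhaustively: the `import` lines (tree modules `Summits.HodgeConjecture.FermatCycles.
HodgeFermat*` instead of `HodgeFermat.*`); this module docstring; DEDUP (the gate's `dedup.landed`, bounce of p400783): the source's last test `theorem uRangeAuto_test : URange 2 36` (l.139) has exactly the statement of the landed test `HodgeFermat.KRFree.HypUCert.uRange_test` (`HodgeFermatHypUCertB.lean`) and is therefore DELETED (used nowhere); one-line docstrings added (gate lint) to `lamPCOf`, `autoPCOf`, `entryOfPrimes`, `entryOf`, `walkAuto_sound`, `walkAuto_test`.
Every other line — in particular every declaration's statement and proof — is byte-identical to the source.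
HONEST FRAMING: explicit algebraic cycles for specific Hodge classes on Fermat/Delsarte varieties; residual open instances
listed; no claim on general Hodge.  (This file is arithmetic of CM types / of `(ℤ/N)ˣ`; it claims nothing about cycles.)

The source module's docstring (HypUAuto.lean l.6–19), verbatim:

## HYPOTHESIS U on a finite range WITHOUT certificate data — the in-kernel certificate generator (HF-G24)

`HypUCert.lean` checks, by `decide +kernel`, externally generated certificates (`Entry`) for the level
inequality `Good N : 6 * ∑ p ∈ N.primeFactors, tau N p < φ(N)`; in generation 23 the 37 data modules
`HypUFinite*.lean` (16.7 MB of certificates) fed it for `N ≤ 10⁶`.  Here the certificate of each level is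
COMPUTED INSIDE THE KERNEL by `autoEntry N` — trial-division factorisation over `smallPrimes`; per prime
`p ∣ N`, with `m = N / p`, a linear search for the first power `p ^ j ≡ ±1 (mod m)` (`j ≤ 64`), falling
back to the exact order obtained by stripping primes from `λ(m) = lcm_{q ∣ m} (q - 1)` — and then CHECKED by
the very same sound checker `entryOK`.  Hence NO property of `autoEntry` is proved or needed:
`walkAuto_sound` is `HypUCert.walk_sound` with the certificate list replaced by the generator, and
`uRange_of_walkAuto : walkAuto (a + k) k = true → URange a (a + k)` gives range theorems with no data
(one line per 1000 levels).
-/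

set_option autoImplicit false

namespace HodgeFermat.KRFree.HypUAuto

open Finset HodgeFermat.KRFree.HypBReduction HodgeFermat.KRFree.HypUCert

/-! ## 1. Arithmetic helpers (unverified: their output is validated by `entryOK`) -/

/-- divide `p` out of `n`: `(n / p ^ e, e0 + e)` (fuel-bounded). -/
def divOut (p : ℕ) : ℕ → ℕ → ℕ → ℕ × ℕ
  | 0, n, e => (n, e)
  | fuel + 1, n, e => if n % p == 0 then divOut p fuel (n / p) (e + 1) else (n, e)

/-- trial-division factorisation of `n` over the ascending list `l`; once `p * p > n` the cofactor
(`1` or a prime, when `l` lists all primes `≤ √n`) is recorded with exponent `1`. -/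
def factorTD : ℕ → List ℕ → List (ℕ × ℕ)
  | n, [] => if Nat.blt 1 n then [(n, 1)] else []
  | n, p :: l =>
      if Nat.blt n (p * p) then (if Nat.blt 1 n then [(n, 1)] else [])
      else
        match divOut p 40 n 0 with
        | (n', e) => if Nat.blt 0 e then (p, e) :: factorTD n' l else factorTD n l

/-- factorisation over the primes `≤ 1600` of `HypUCert.smallPrimes` (complete below `1601 ^ 2`). -/
def factor (n : ℕ) : List (ℕ × ℕ) := factorTD n smallPrimes

/-! ## 2. The order certificate of one prime `p ∣ N` (`m = N / p`) -/

/-- linear search, `x = p ^ j mod m`: the first `j` (at most `fuel` steps) with `p ^ j ≡ -1`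
(type `A`) or `p ^ j ≡ 1` (type `B`, order `j`). -/
def linSearch (p m : ℕ) : ℕ → ℕ → ℕ → Option PC
  | 0, _, _ => none
  | fuel + 1, j, x =>
      if x == (m - 1) % m then some (A p j)
      else if x == 1 % m then some (B p j (factor j))
      else linSearch p m fuel (j + 1) (x * p % m)

/-- strip the prime `r` from the multiple `d` of the order while `p ^ (d / r) ≡ 1 (mod m)`. -/
def strip (p m r : ℕ) : ℕ → ℕ → ℕ
  | 0, d => d
  | fuel + 1, d =>
      if d % r == 0 && (powMod p (d / r) m == 1 % m) then strip p m r fuel (d / r) else d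

/-- reduce the multiple `d` of the order along the factorisation `fac` of `d`: the exact order. -/
def reduceOrd (p m : ℕ) : ℕ → List (ℕ × ℕ) → ℕ
  | d, [] => d
  | d, (r, e) :: fac => reduceOrd p m (strip p m r e d) fac

/-- from the exact order `d`: type `A` with `k = d / 2` if `p ^ (d/2) ≡ -1`, else type `B`. -/
def pcOfOrd (p m d : ℕ) : PC :=
  if d % 2 == 0 && (powMod p (d / 2) m == (m - 1) % m) then A p (d / 2) else B p d (factor d)

/-- `λ(m) = lcm_{q ∣ m} (q - 1)` for `m = ∏ (ps.erase p)` squarefree. -/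
def lam (p : ℕ) (ps : List ℕ) : ℕ := (ps.erase p).foldl (fun acc q => Nat.lcm acc (q - 1)) 1

/-- the certificate for `p` from a multiple `L` of its order mod `m` -/
def lamPCOf (p m L : ℕ) : PC := pcOfOrd p m (reduceOrd p m L (factor L))

/-- the certificate for `p` via the exact order computed from `λ(m)`. -/
def lamPC (p m : ℕ) (ps : List ℕ) : PC := lamPCOf p m (lam p ps)

/-- the certificate for `p` mod `m`: linear search first, the `λ(m)` route as fall-back -/
def autoPCOf (ps : List ℕ) (p m : ℕ) : PC :=
  match linSearch p m 64 1 (p % m) with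
  | some c => c
  | none => lamPC p m ps

/-- the certificate for the prime `p ∣ N` (`ps` = the primes of `N`, `m = N / p`). -/
def autoPC (N : ℕ) (ps : List ℕ) (p : ℕ) : PC := autoPCOf ps p (N / p)

/-! ## 3. The certificate of a level; the walk -/

/-- the certificate entry of a squarefree level from its prime list (`P` for a prime) -/
def entryOfPrimes (N : ℕ) : List ℕ → Entry
  | [_] => .P
  | ps => .L ps (ps.map (autoPC N ps))

/-- the certificate entry of a level from its factorisation (`S q` if `q² ∣ N`) -/
def entryOf (N : ℕ) (fs : List (ℕ × ℕ)) : Entry :=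
  match fs.find? (fun qe => Nat.ble 2 qe.2) with
  | some qe => .S qe.1
  | none => entryOfPrimes N (fs.map Prod.fst)

/-- the in-kernel certificate of the level `N` (`N` prime to `6`): `S q` if `q² ∣ N`, `P` if `N` is prime,
else `L [p₁,…,p_k] [c₁,…,c_k]`. -/
def autoEntry (N : ℕ) : Entry := entryOf N (factor N)

/-- Walk `N = top - fuel, …, top - 1` exactly as `HypUCert.walk`, generating each certificate
instead of reading it. -/
def walkAuto (top : ℕ) : ℕ → Bool
  | 0 => true
  | fuel + 1 =>
      if (top - (fuel + 1)) % 2 = 0 ∨ (top - (fuel + 1)) % 3 = 0 then walkAuto top fuel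
      else entryOK (top - (fuel + 1)) (autoEntry (top - (fuel + 1))) && walkAuto top fuel

/-- soundness of the certificate-free walk (`HypUCert.walk_sound` with generated certificates) -/
theorem walkAuto_sound (top : ℕ) : ∀ fuel : ℕ, walkAuto top fuel = true →
    ∀ n, top - fuel ≤ n → n < top → ¬ 2 ∣ n → ¬ 3 ∣ n → Squarefree n → Good n
  | 0, _, n, h1, h2, _, _, _ => by omega
  | fuel + 1, h, n, h1, h2, h2n, h3n, hsq => by
      unfold walkAuto at h
      split_ifs at h with hdiv
      · rcases Nat.eq_or_lt_of_le h1 with heq | hlt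
        · exfalso
          rw [heq] at hdiv
          rcases hdiv with h0 | h0
          · exact h2n (Nat.dvd_of_mod_eq_zero h0)
          · exact h3n (Nat.dvd_of_mod_eq_zero h0)
        · exact walkAuto_sound top fuel h n (by omega) h2 h2n h3n hsq
      · simp only [Bool.and_eq_true] at h
        rcases Nat.eq_or_lt_of_le h1 with heq | hlt
        · rw [heq] at h
          exact entryOK_sound n _ h.1 hsq
        · exact walkAuto_sound top fuel h.2 n (by omega) h2 h2n h3n hsq

/-- The range statement `URange a (a + k)` of `HypUDefs.lean` from a checked certificate-free walk. -/
theorem uRange_of_walkAuto (a k : ℕ) (hw : walkAuto (a + k) k = true) : URange a (a + k) :=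
  fun n ha hb _ hsq h2 h3 => walkAuto_sound (a + k) k hw n (by omega) hb h2 h3 hsq

/-! ## 4. Test (`N < 36`, cf. `HypUCert.walk_test`) -/

/-- the certificate-free test walk checks (kernel evaluation) -/
theorem walkAuto_test : walkAuto 36 31 = true := by decide +kernel

-- `uRangeAuto_test : URange 2 36` (source l.139): DELETED — same statement as the landed test `HypUCert.uRange_test` (gate dedup).

end HodgeFermat.KRFree.HypUAuto
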